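import Summits.QuantumFields.BalabanUV.Beta.EriceFlowEnclosureB12AsPrintedPointwiseFading
import Summits.QuantumFields.BalabanUV.Beta.EriceFlowEnclosureB12AsPrintedPointwiseHistoryWitness

/-!
# Beta / EriceFlowEnclosureB12AsPrintedPointwiseFadingWitness — WHAT (0.31) FORCES POINTWISE, witness part 6b: THE COUPLING-CHART MODULUS IS LOAD-BEARING.  Part 4's
# two-coupling family (β_{k+1} reads 1∕g_{k−1}² − 1∕g_k², [I] p. 298) admits NO history modulus in the COUPLING chart on any box: at scale 1 the two histories
# (g₀, δ), (g₀′, δ) with increments ½ and 1 lie in ]0, δ]² and carry β_2 = −½ and β_2 = 1 — an oscillation 3∕2 in the preceding coupling INSIDE EVERY BOX, so neither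
# part 5's oscillation letter `hosc` nor node U2's `HistLipschitz` (fading or not) holds; yet the toy has every OTHER hypothesis of parts 5∕6's ENDs (g-uniform (0.31),
# Theorem 2 as typed, `Definitions`, (U), `hrg`, even uniqueness) and ¬`BetaSignH`.  And the dip toy of part 3 (Markov, so `hosc` with Λ = 0) has, by part 5 read
# contrapositively, NO local uniqueness on any ]0, g₂] (β-flow team, prover 2 = lower ∕ positivity side, unit `b2b-balaban-beta-bflow-p2`, gen 43; ROW AP-I × ROW U;
# parts 5∕6 `…PointwiseCover ∕ …PointwiseFading` = the positive side)

HONEST FRAMING (page 1 of everything the β sub-cell writes): discharging `BetaPertH` makes Bałaban's UV stability UNCONDITIONAL — a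
real constructive-QFT result; it is NOT the continuum limit and NOT the Clay problem.  HONEST DEPENDENCY (cell reorg 2026-08-19,
verbatim): «continuum YM on T⁴ ⇐ BetaPertH ∧ nine spine estimates (0/9 proved); BetaPertH ⇐ (D1) ∧ (D4) ∧ CAP+tail; G-an2-4 gates
asym, D1 and NE2/3/4.»  THIS MODULE DISCHARGES NOTHING and says NOTHING about Bałaban's objects: toy families of ours (part 4's two-coupling family through
its DEFINING HYPOTHESIS `hβ`; the def-free settings of `…PointwiseHistoryWitness` and `…PointwiseWitness`) on the carrier of `B12BetaAsPrinted` ([Balaban1987RG1]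
as typed; Theorem 2 STATED WITHOUT PROOF, p. 259, is PROVED for the toys); node U2's `HistLipschitz` is a HYPOTHESIS SHAPE (GAPS G-t4-U2-2), refuted here FOR THE
TOY only.

WHAT THIS FILE PROVES (0 sorry, 0 def):
§1 (the two-coupling family, hypotheses `hDip`, `hβ` of part 4a) **`osc_pair_hist`** (for every δ > 0: histories p, q ∈ ]0, δ]² with the same last coupling δ and
   β_2(q) − β_2(p) = 3∕2), **`not_histOsc_hist`** (no oscillation letter Λδ on the boxes ]0, δ], δ ≤ γ_U, for any Λ, γ_U > 0), **`not_histLipschitz_hist`** (no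
   `HistLipschitz Λ γ_U S.β` for any Λ, γ_U > 0 — a fortiori none with `FadingMemory`).
§2 (settings) **`fading_loadBearing`** (∃ S, hH: [I]'s typed content ∧ g-uniform (0.31) ∧ `Theorem2Statement` ∧ uniqueness on ]0, ½] ∧ (U)(C)(264)`hrg` ∧ NO `hosc` ∧ NO
   `HistLipschitz` ∧ ¬`BetaSignH` ∧ ¬`BetaAFH`), **`not_betaAFH_without_modulus_schema`** (part 6's END with the moduli deleted — even keeping uniqueness — and part 5's
   END with `hosc` deleted are FALSE as schemata), **`not_localUnique_markov_witness`** (the dip toy: Markov, typed Theorem 2 with g-uniform constants, `Definitions`,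
   (U), `hrg`, and NO local uniqueness on ANY ]0, g₂], at every m — part 5's `betaSignH_of_theorem2_unique_markov` contrapositively; part 3 showed it on ]0, ½] at m = 0).
NOT CLAIMED: that the toys resemble Bałaban's (1.22); any letter for it; Theorem 2; `BetaPertH`; continuum; Clay.
-/

namespace Summit.QuantumFields.BalabanUV.Beta.EriceFlowEnclosureB12AsPrintedPointwiseFadingWitness

open Real (smoothTransition)
open Literature.MathematicalPhysics.QuantumFieldTheory.Balaban1983to89
open Literature.MathematicalPhysics.QuantumFieldTheory.Balaban1983to89.B12BetaAsPrinted
open Literature.MathematicalPhysics.QuantumFieldTheory.Balaban1983to89.B12CouplingClausesHistory (BetaSmoothInLast264)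
open Literature.MathematicalPhysics.QuantumFieldTheory.Balaban1983to89.FlowStep (prefixOf Box mem_box box_mono BetaContH BetaLowerH BetaUpperH
  BetaSignH BetaAFH RGEqH betaSignH_of_AFH)
open Literature.MathematicalPhysics.QuantumFieldTheory.Balaban1983to89.T4CouplingMatching (HistLipschitz)
open Summit.QuantumFields.BalabanUV.Beta.EriceFlowEnclosureB12AsPrintedPointwiseDip (dip_center dip_eq_zero_of_ge)
open Summit.QuantumFields.BalabanUV.Beta.EriceFlowEnclosureB12AsPrintedPointwiseWitness (sign_not_forced_without_uniqueness)
open Summit.QuantumFields.BalabanUV.Beta.EriceFlowEnclosureB12AsPrintedPointwiseHistory (letters_hist uniformTheorem2_not_betaSignH_hist unique_hist)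
open Summit.QuantumFields.BalabanUV.Beta.EriceFlowEnclosureB12AsPrintedPointwiseHistoryWitness (histToy_exists)
open Summit.QuantumFields.BalabanUV.Beta.EriceFlowEnclosureB12AsPrintedPointwiseCover (betaSignH_of_theorem2_unique_markov)

noncomputable section

section Family

variable {D : ℕ → ℝ → ℝ}
  (hDip : ∀ (k : ℕ) (y : ℝ), D k y = smoothTransition (2 * (y - ((k : ℝ) + 4))) * smoothTransition (2 * (((k : ℝ) + 4) + 1 - y)))
  {S : Setting}
  (hβ : ∀ (k : ℕ) (p : Fin (k + 1) → ℝ), S.β k p = if p (Fin.last k) = 0 then 1 else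
    1 - 3 / 2 * D 0 (1 / (p ⟨k - 1, Nat.lt_succ_of_le (Nat.sub_le k 1)⟩) ^ 2 - 1 / (p (Fin.last k)) ^ 2 + 4))
include hDip hβ

/-! ## §1 The two-coupling family oscillates by 3∕2 in the preceding coupling inside every box -/

/-- **THE OSCILLATING PAIR.**  For every δ > 0 the two scale-1 histories p = (g₀, δ), q = (g₀′, δ) with 1∕g₀² = 1∕δ² + ½ and 1∕g₀′² = 1∕δ² + 1 lie in the box ]0, δ]², share the
last coupling, and carry β_2(p) = −½ (the dip's bottom) and β_2(q) = 1 (outside the dip): `β_2(q) − β_2(p) = 3∕2`. [cite: Balaban1987RG1, p.298 («depends also on all preceding coupling constants»)] -/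
theorem osc_pair_hist {δ : ℝ} (hδ : 0 < δ) :
    ∃ p q : Fin 2 → ℝ, p ∈ Box δ 1 ∧ q ∈ Box δ 1 ∧ p (Fin.last 1) = q (Fin.last 1) ∧ |p 0 - q 0| ≤ δ ∧
      S.β 1 p = -(1 / 2) ∧ S.β 1 q = 1 ∧ S.β 1 q - S.β 1 p = 3 / 2 := by
  have hlev : ∀ c : ℝ, 0 ≤ c → 0 < 1 / δ ^ 2 + c := fun c hc => by positivity
  have hsq : ∀ c : ℝ, 0 ≤ c → 1 / (1 / Real.sqrt (1 / δ ^ 2 + c)) ^ 2 = 1 / δ ^ 2 + c := fun c hc => by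
    rw [div_pow, one_pow, Real.sq_sqrt (hlev c hc).le, one_div_one_div]
  have hle : ∀ c : ℝ, 0 ≤ c → 1 / Real.sqrt (1 / δ ^ 2 + c) ≤ δ := fun c hc => by
    have h1 : 1 / δ ≤ Real.sqrt (1 / δ ^ 2 + c) := (Real.le_sqrt' (by positivity)).2 (by rw [div_pow, one_pow]; linarith)
    exact (one_div_le_one_div_of_le (by positivity) h1).trans_eq (one_div_one_div δ)
  set g₀ : ℝ := 1 / Real.sqrt (1 / δ ^ 2 + 1 / 2) with hg₀
  set g₀' : ℝ := 1 / Real.sqrt (1 / δ ^ 2 + 1) with hg₀'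
  have hg₀pos : 0 < g₀ := one_div_pos.2 (Real.sqrt_pos.2 (hlev _ (by norm_num)))
  have hg₀'pos : 0 < g₀' := one_div_pos.2 (Real.sqrt_pos.2 (hlev _ (by norm_num)))
  have hl : ∀ a : ℝ, (![a, δ] : Fin 2 → ℝ) (Fin.last 1) = δ := fun _ => rfl
  have hp0 : ∀ a : ℝ, (![a, δ] : Fin 2 → ℝ) ⟨1 - 1, Nat.lt_succ_of_le (Nat.sub_le 1 1)⟩ = a := fun _ => rfl
  have hβp : S.β 1 ![g₀, δ] = -(1 / 2) := by
    rw [hβ, hl, if_neg hδ.ne', hp0, hsq _ (by norm_num), show (1 : ℝ) / δ ^ 2 + 1 / 2 - 1 / δ ^ 2 + 4 = ((0 : ℕ) : ℝ) + 4 + 1 / 2 by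
      push_cast; ring, dip_center hDip 0]
    norm_num
  have hβq : S.β 1 ![g₀', δ] = 1 := by
    rw [hβ, hl, if_neg hδ.ne', hp0, hsq _ (by norm_num), show (1 : ℝ) / δ ^ 2 + 1 - 1 / δ ^ 2 + 4 = 5 by ring,
      dip_eq_zero_of_ge hDip 0 (by norm_num)]
    ring
  refine ⟨![g₀, δ], ![g₀', δ], ?_, ?_, rfl, ?_, hβp, hβq, by rw [hβp, hβq]; norm_num⟩
  · rw [mem_box]; intro i; fin_cases i
    · exact ⟨hg₀pos, hle _ (by norm_num)⟩
    · exact ⟨hδ, le_rfl⟩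
  · rw [mem_box]; intro i; fin_cases i
    · exact ⟨hg₀'pos, hle _ (by norm_num)⟩
    · exact ⟨hδ, le_rfl⟩
  · show |g₀ - g₀'| ≤ δ
    rw [abs_sub_le_iff]
    constructor <;> linarith [hle _ (by norm_num : (0 : ℝ) ≤ 1 / 2), hle _ (by norm_num : (0 : ℝ) ≤ 1)]

/-- **NO OSCILLATION LETTER IN THE COUPLING CHART.**  For no Λ and no γ_U > 0 does the two-coupling family satisfy part 5's letter `hosc` («|β_{k+1}(p) − β_{k+1}(q)| ≤ Λδ for p, q ∈
]0, δ]^{k+1} with the same last coupling, all δ ≤ γ_U»): at δ = min(γ_U, 1∕(|Λ| + 1)) the pair of `osc_pair_hist` oscillates by 3∕2 > Λδ.  Its history dependence does NOT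
fade at zero coupling. [cite: Balaban1987RG1, p.298] -/
theorem not_histOsc_hist (Λ : ℝ) {γU : ℝ} (hγU : 0 < γU) :
    ¬ ∀ δ : ℝ, 0 < δ → δ ≤ γU → ∀ (k : ℕ) (p q : Fin (k + 1) → ℝ), p ∈ Box δ k → q ∈ Box δ k →
      p (Fin.last k) = q (Fin.last k) → |S.β k p - S.β k q| ≤ Λ * δ := by
  intro h
  set δ : ℝ := min γU (1 / (|Λ| + 1)) with hδ
  have hδpos : 0 < δ := lt_min hγU (by positivity)
  obtain ⟨p, q, hp, hq, hl, -, -, -, hosc⟩ := osc_pair_hist hDip hβ hδpos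
  have h1 := h δ hδpos (min_le_left _ _) 1 p q hp hq hl
  rw [abs_sub_comm] at h1
  have h2 : |S.β 1 q - S.β 1 p| = 3 / 2 := by rw [hosc]; norm_num
  have h3 : Λ * δ ≤ |Λ| * δ := mul_le_mul_of_nonneg_right (le_abs_self Λ) hδpos.le
  have h4 : |Λ| * δ ≤ |Λ| * (1 / (|Λ| + 1)) := mul_le_mul_of_nonneg_left (min_le_right _ _) (abs_nonneg Λ)
  have h5 : |Λ| * (1 / (|Λ| + 1)) < 1 := by
    rw [mul_one_div, div_lt_one (by positivity)]; linarith
  linarith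

/-- **NO COUPLING-CHART HISTORY MODULUS AT ALL**: for no Λ : ℕ → ℕ → ℝ and no γ_U > 0 does the two-coupling family satisfy node U2's `HistLipschitz Λ γ_U S.β` — at scale 1 the pair of
`osc_pair_hist` inside ]0, δ]², δ = min(γ_U, 1∕(|Λ 1 0| + 1)), has |β_2(p) − β_2(q)| = 3∕2 > Λ 1 0·|p₀ − q₀| + Λ 1 1·0.  A fortiori no `HistLipschitz` with `FadingMemory`: part 6's
END does not reach this family, consistently with ¬`BetaSignH` (part 4). (The family IS Lipschitz in the chart 1∕g²; the coupling chart is what parts 5∕6 need.)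
[cite: Balaban1987RG1, p.298] -/
theorem not_histLipschitz_hist (Λ : ℕ → ℕ → ℝ) {γU : ℝ} (hγU : 0 < γU) : ¬ HistLipschitz Λ γU S.β := by
  intro hL
  set δ : ℝ := min γU (1 / (|Λ 1 0| + 1)) with hδ
  have hδpos : 0 < δ := lt_min hγU (by positivity)
  have hδU : δ ≤ γU := min_le_left _ _
  obtain ⟨p, q, hp, hq, hl, hd0, -, -, hosc⟩ := osc_pair_hist hDip hβ hδpos
  have h1 := hL 1 p q (box_mono hδU 1 hp) (box_mono hδU 1 hq)
  rw [Fin.sum_univ_two, abs_sub_comm] at h1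
  have hl' : p 1 - q 1 = 0 := by have : (Fin.last 1 : Fin 2) = 1 := rfl; rw [← this, hl, sub_self]
  rw [hl', abs_zero, mul_zero, add_zero] at h1
  have h2 : |S.β 1 q - S.β 1 p| = 3 / 2 := by rw [hosc]; norm_num
  have h3 : Λ 1 ((0 : Fin 2) : ℕ) * |p 0 - q 0| ≤ |Λ 1 0| * δ := by
    calc Λ 1 ((0 : Fin 2) : ℕ) * |p 0 - q 0| ≤ |Λ 1 ((0 : Fin 2) : ℕ)| * |p 0 - q 0| :=
          mul_le_mul_of_nonneg_right (le_abs_self _) (abs_nonneg _)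
      _ ≤ |Λ 1 0| * δ := mul_le_mul_of_nonneg_left hd0 (abs_nonneg _)
  have h4 : |Λ 1 0| * δ ≤ |Λ 1 0| * (1 / (|Λ 1 0| + 1)) := mul_le_mul_of_nonneg_left (min_le_right _ _) (abs_nonneg _)
  have h5 : |Λ 1 0| * (1 / (|Λ 1 0| + 1)) < 1 := by
    rw [mul_one_div, div_lt_one (by positivity)]; linarith
  linarith

end Family

/-! ## §2 On settings: the modulus letters of parts 5∕6 are load-bearing -/

/-- **THE COUPLING-CHART MODULUS IS LOAD-BEARING IN PARTS 5∕6.**  The def-free two-coupling setting of part 4b (`histToy_exists`: L = 13, γ = ½): [I]'s whole typed content,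
(0.31) with g-UNIFORM constants, Theorem 2 AS TYPED, UNIQUENESS of the in-interval run with given (K, m, endpoint) on ]0, ½] (hence local uniqueness), (U) `BetaUpperH 1 (1∕2)`, (C),
p. 264's clause box-wide, `hrg` — EVERY hypothesis of `…PointwiseFading.betaAFH_of_uniformTheorem2_fadingMemory` and of `…PointwiseCover.betaAFH_of_uniformTheorem2_unique_histOsc`
EXCEPT the modulus ∕ oscillation letter — and: NO `hosc` for any (Λ, γ_U), NO `HistLipschitz Λ γ_U` for any (Λ, γ_U), ¬`BetaSignH`, ¬`BetaAFH`.
[cite: Balaban1987RG1, Thm 2 (0.31) p.259 and p.298] -/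
theorem fading_loadBearing :
    ∃ (S : Setting) (hH : StandingHypotheses S), Definitions S ∧ Conclusions S ∧ B12BetaAsPrinted S ∧
      (∀ m : ℕ, ∃ γ₀ : ℝ, 0 < γ₀ ∧ ∀ γ : ℝ, 0 < γ → γ ≤ γ₀ → ∃ g₁ : ℝ, 0 < g₁ ∧ ∃ β β' : ℝ, 0 < β ∧ β ≤ β' ∧
        ∀ g : ℝ, 0 < g → g ≤ g₁ → ∀ K : ℕ, ∃ g₀ : ℝ, Step.InInterval γ K (S.cpl ⟨K, m, g₀⟩) ∧ S.cpl ⟨K, m, g₀⟩ K = g ∧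
          Step.Discrete031 (β * Real.log S.L) (β' * Real.log S.L) K g (S.cpl ⟨K, m, g₀⟩)) ∧
      Theorem2Statement S (hL_of_standing hH) ∧
      (∀ (K m : ℕ) (g₀ g₀' : ℝ), Step.InInterval (1 / 2) K (S.cpl ⟨K, m, g₀⟩) → Step.InInterval (1 / 2) K (S.cpl ⟨K, m, g₀'⟩) →
        S.cpl ⟨K, m, g₀⟩ K = S.cpl ⟨K, m, g₀'⟩ K → g₀ = g₀') ∧
      BetaUpperH 1 (1 / 2) S.β ∧ BetaContH (1 / 2) S.β ∧ BetaSmoothInLast264 (1 / 2) S.β ∧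
      (∀ P : B12.RunParams, Step.InInterval (1 / 2) P.K (S.cpl P) → RGEqH P.K S.β (S.cpl P)) ∧
      (∀ (Λ γU : ℝ), 0 < γU → ¬ ∀ δ : ℝ, 0 < δ → δ ≤ γU → ∀ (k : ℕ) (p q : Fin (k + 1) → ℝ), p ∈ Box δ k → q ∈ Box δ k →
        p (Fin.last k) = q (Fin.last k) → |S.β k p - S.β k q| ≤ Λ * δ) ∧
      (∀ (Λ : ℕ → ℕ → ℝ) (γU : ℝ), 0 < γU → ¬ HistLipschitz Λ γU S.β) ∧
      ¬ BetaSignH S.β ∧ ¬ BetaAFH S.β := by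
  have hDip : ∀ (k : ℕ) (y : ℝ), (fun (k : ℕ) (y : ℝ) => smoothTransition (2 * (y - ((k : ℝ) + 4))) *
      smoothTransition (2 * (((k : ℝ) + 4) + 1 - y))) k y =
      smoothTransition (2 * (y - ((k : ℝ) + 4))) * smoothTransition (2 * (((k : ℝ) + 4) + 1 - y)) := fun _ _ => rfl
  obtain ⟨S, hβ, -, -, hH, hD, hC, hnS⟩ := histToy_exists hDip
  obtain ⟨hU, hCt, hSm, hrg⟩ := letters_hist hDip hβ hD
  obtain ⟨hTu, hT, -⟩ := uniformTheorem2_not_betaSignH_hist hDip hβ hH hD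
  exact ⟨S, hH, hD, hC, fun _ _ => hC, hTu, hT, fun K m g₀ g₀' hI hI' hend => unique_hist hDip hβ hD hrg K m g₀ g₀' hI hI' hend,
    hU, hCt, hSm, hrg, fun Λ γU hγU => not_histOsc_hist hDip hβ Λ hγU, fun Λ γU hγU => not_histLipschitz_hist hDip hβ Λ hγU, hnS,
    fun hAF => hnS (betaSignH_of_AFH hAF)⟩

/-- **PARTS 5∕6's ENDs WITH THE MODULUS DELETED ARE FALSE AS SCHEMATA** — even with UNIQUENESS kept: «[I]'s typed content + g-uniform (0.31) + uniqueness of in-]0, γ]-interval runs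
+ (U) + `hrg` on ]0, γ] ⟹ `BetaAFH S.β`» fails (γ = ½, the two-coupling toy; indeed ¬`BetaSignH`).  So in `betaAFH_of_uniformTheorem2_fadingMemory` the moduli do more than
supply uniqueness (they also give `hosc`), and in `betaAFH_of_uniformTheorem2_unique_histOsc` the letter `hosc` cannot be dropped. [cite: Balaban1987RG1, Thm 2 (0.31) p.259 and p.298] -/
theorem not_betaAFH_without_modulus_schema :
    ¬ ∀ (S : Setting) (hH : StandingHypotheses S), Definitions S → Conclusions S →
        (∀ m : ℕ, ∃ γ₀ : ℝ, 0 < γ₀ ∧ ∀ γ : ℝ, 0 < γ → γ ≤ γ₀ → ∃ g₁ : ℝ, 0 < g₁ ∧ ∃ β β' : ℝ, 0 < β ∧ β ≤ β' ∧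
          ∀ g : ℝ, 0 < g → g ≤ g₁ → ∀ K : ℕ, ∃ g₀ : ℝ, Step.InInterval γ K (S.cpl ⟨K, m, g₀⟩) ∧ S.cpl ⟨K, m, g₀⟩ K = g ∧
            Step.Discrete031 (β * Real.log S.L) (β' * Real.log S.L) K g (S.cpl ⟨K, m, g₀⟩)) →
        ∀ γ : ℝ, 0 < γ →
          (∀ (K m : ℕ) (g₀ g₀' : ℝ), Step.InInterval γ K (S.cpl ⟨K, m, g₀⟩) → Step.InInterval γ K (S.cpl ⟨K, m, g₀'⟩) →
            S.cpl ⟨K, m, g₀⟩ K = S.cpl ⟨K, m, g₀'⟩ K → g₀ = g₀') →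
          BetaUpperH 1 γ S.β → (∀ P : B12.RunParams, Step.InInterval γ P.K (S.cpl P) → RGEqH P.K S.β (S.cpl P)) → BetaAFH S.β := by
  intro h
  obtain ⟨S, hH, hD, hC, -, hTu, -, huniq, hU, -, -, hrg, -, -, -, hnAF⟩ := fading_loadBearing
  exact hnAF (h S hH hD hC hTu (1 / 2) (by norm_num) huniq hU hrg)

/-- **THE DIP TOY HAS NO LOCAL UNIQUENESS ON ANY ]0, g₂]** (part 5 read contrapositively).  Part 3's def-free dip setting (`sign_not_forced_without_uniqueness`: Markov β, [I]'s typed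
content, g-uniform (0.31), Theorem 2 as typed, (U), `hrg` on ]0, ½], ¬`BetaSignH`) violates, for EVERY m and EVERY g₂ > 0, uniqueness of in-]0, g₂]-interval runs with a common
endpoint — otherwise part 5's `betaSignH_of_theorem2_unique_markov` would give `BetaSignH`.  Part 3 exhibited two bare couplings on ]0, ½] at m = 0 by hand; here the
non-uniqueness reaches every neighbourhood of zero, with no further computation. [cite: Balaban1987RG1, Thm 2 p.259 («g₀ = g₀(ε, g)») with p.298] -/
theorem not_localUnique_markov_witness :
    ∃ (S : Setting) (hH : StandingHypotheses S), Definitions S ∧ Conclusions S ∧ Theorem2Statement S (hL_of_standing hH) ∧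
      (∀ (k : ℕ) (p q : Fin (k + 1) → ℝ), p (Fin.last k) = q (Fin.last k) → S.β k p = S.β k q) ∧
      BetaUpperH 1 (1 / 2) S.β ∧ (∀ P : B12.RunParams, Step.InInterval (1 / 2) P.K (S.cpl P) → RGEqH P.K S.β (S.cpl P)) ∧
      ¬ BetaSignH S.β ∧
      ∀ (m : ℕ) (g₂ : ℝ), 0 < g₂ → ¬ ∀ (K : ℕ) (g₀ g₀' : ℝ), Step.InInterval g₂ K (S.cpl ⟨K, m, g₀⟩) →
        Step.InInterval g₂ K (S.cpl ⟨K, m, g₀'⟩) → S.cpl ⟨K, m, g₀⟩ K = S.cpl ⟨K, m, g₀'⟩ K → g₀ = g₀' := by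
  obtain ⟨S, βE, hH, hD, hC, -, -, -, hT, hM, hU, -, -, hrg, -, -, hnot, -⟩ := sign_not_forced_without_uniqueness
  refine ⟨S, hH, hD, hC, hT, hM, hU, hrg, hnot, fun m g₂ hg₂ huniq => hnot ?_⟩
  exact betaSignH_of_theorem2_unique_markov hT hD m hM (by norm_num : (0 : ℝ) < 1 / 2) hrg hU ⟨g₂, hg₂, huniq⟩

end

end Summit.QuantumFields.BalabanUV.Beta.EriceFlowEnclosureB12AsPrintedPointwiseFadingWitness
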